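import Summits.Langlands.Langlands.Theses.HeckeFieldDeRham
import Summits.Langlands.Langlands.Theorems.IrreducibilityBySelfDualityReciprocityUpToIrreducibilityCorrespondsConj

/-!
# Line `leaves` — ∀Rec VARIANT, ready for the lock-step re-type of `HeckeFieldDeRham.ReciprocityModuloDeRham`

If the route-repair planner restates the crux (stmt-Langlands-17410) to the refuter's lock-step form C′
(`Nonempty (ReciprocityData F) ∧ ∀ Rec …`, RETYPE-NEEDED 2026-08-17T05:20Z), the registered skeletons `Lines/leaves.lean` /
`Lines/primeswitch.lean` (which conclude the ∃Rec decl by name) stop elaborating.  This file is the replacement for `leaves`: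
four stubs — N (non-vacuity of reciprocity data; a THEOREM in print, formalisation debt), W⁺, B_w (verbatim as before), LGC°
in ∀Rec form (certified implied by the summit: `pairCompatibilityModuloDeRham_forall_of_langlands`) — and the composition
`ReciprocityModuloDeRham'_of`, concluding C′ stated here as a local `def ReciprocityModuloDeRham'` (post-retype: delete the
def and let the name denote the route decl; nothing else changes).  rc 0, sorries 4 = stubs, std axioms.
-/

set_option linter.dupNamespace false

namespace Summit.Langlands.Langlands.Theses.HeckeFieldDeRham

open scoped BigOperators Topology Manifold Classical MeasureTheory ProbabilityTheory Matrix InnerProductSpace ComplexConjugate ContinuousMap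
open Filter Set Function TopologicalSpace MeasureTheory

/-- C′ — the lock-step ∀Rec re-type of the crux (refuter's `ReciprocityModuloDeRham'`, text). -/
def ReciprocityModuloDeRham' : Prop :=
  ∀ (F : Type) [Field F] [NumberField F], Nonempty (Summit.Langlands.ReciprocityData F) ∧ ∀ (Rec : Summit.Langlands.ReciprocityData F) (n : ℕ), 0 < n → ∀ hcpt : Literature.NumberTheory.Automorphic.isCompact_glFiniteIntegralLevel n F, (∀ π : Literature.NumberTheory.Automorphic.CuspidalAutomorphicRepData n F hcpt, π.1.IsLAlgebraic → ∀ (ℓ : ℕ) [Fact ℓ.Prime] (ι : PadicAlgCl ℓ ≃+* ℂ), ∃ ρ : Literature.NumberTheory.GaloisRepresentations.FramedGaloisRep F (PadicAlgCl ℓ) n, ρ.toGaloisRep.IsIrreducible ∧ (∀ᶠ v : IsDedekindDomain.HeightOneSpectrum (NumberField.RingOfIntegers F) in Filter.cofinite, Summit.Langlands.SatakeFrobCompatibleAt ι π.1 ρ v) ∧ (∀ v : IsDedekindDomain.HeightOneSpectrum (NumberField.RingOfIntegers F), ((ℓ : ℕ) : NumberField.RingOfIntegers F) ∉ v.asIdeal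 → Summit.Langlands.LocalGlobalCompatibleAt Rec ι π.1 ρ v) ∧ (∀ (v : IsDedekindDomain.HeightOneSpectrum (NumberField.RingOfIntegers F)) (hv : ((ℓ : ℕ) : NumberField.RingOfIntegers F) ∈ v.asIdeal), (Rec.pst ℓ v hv).IsDeRhamFramed (ρ.toLocal v) → Summit.Langlands.LocalGlobalCompatibleAt Rec ι π.1 ρ v) ∧ (∀ ρ' : Literature.NumberTheory.GaloisRepresentations.FramedGaloisRep F (PadicAlgCl ℓ) n, Summit.Langlands.Corresponds Rec ι π.1 ρ' → Summit.Langlands.IsConjugate ρ ρ')) ∧ Summit.Langlands.GaloisToAutomorphic n Rec hcpt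

namespace Cruxes.ReciprocityModuloDeRham.LeavesForall

/-- **N — reciprocity data exist** (support; Harris–Taylor Thm A / Henniart at every completion + the canonical Artin /
ε pins, Lubin–Tate; in tree the T0 debt `LocalLanglandsDatum.nonempty` + `LocalArtinData.isCanonical_of_unique`).
[cite: HarrisTaylorAMS2001, Thm. A] -/
theorem stub_reciprocityDataExist :
    ∀ (K : Type) [Field K] [NumberField K], Nonempty (ReciprocityData K) := by
  sorry

/-- **W⁺** (VERBATIM stmt-Langlands-17415). [cite: BuzzardGeeLMS2014, Conj. 3.2.2] -/
theorem stub_satakeAvatarExistence :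
    ∀ (K : Type) [Field K] [NumberField K] (n : ℕ) (hcpt : Literature.NumberTheory.Automorphic.isCompact_glFiniteIntegralLevel n K), 0 < n → ∀ (π : Literature.NumberTheory.Automorphic.CuspidalAutomorphicRepData n K hcpt), π.1.IsLAlgebraic → ∀ (ℓ : ℕ) [Fact ℓ.Prime] (ι : PadicAlgCl ℓ ≃+* ℂ), ∃ ρ : Literature.NumberTheory.GaloisRepresentations.FramedGaloisRep K (PadicAlgCl ℓ) n, ρ.toGaloisRep.IsIrreducible ∧ ∀ᶠ v : IsDedekindDomain.HeightOneSpectrum (NumberField.RingOfIntegers K) in cofinite, SatakeFrobCompatibleAt ι π.1 ρ v := by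
  sorry

/-- **B_w** (VERBATIM stmt-Langlands-17414). [cite: FontaineMazurGeometric1995, Conj. 1] -/
theorem stub_weakGeometricAutomorphy :
    ∀ (K : Type) [Field K] [NumberField K] (n : ℕ) (hcpt : Literature.NumberTheory.Automorphic.isCompact_glFiniteIntegralLevel n K), 0 < n → ∀ (ℓ : ℕ) [Fact ℓ.Prime] (ι : PadicAlgCl ℓ ≃+* ℂ) (ρ : Literature.NumberTheory.GaloisRepresentations.FramedGaloisRep K (PadicAlgCl ℓ) n), ρ.toGaloisRep.IsIrreducible → ((∀ᶠ v : IsDedekindDomain.HeightOneSpectrum (NumberField.RingOfIntegers K) in cofinite, ρ.IsUnramifiedAt v) ∧ ∀ (v : IsDedekindDomain.HeightOneSpectrum (NumberField.RingOfIntegers K)) (hv : ((ℓ : ℕ) : NumberField.RingOfIntegers K) ∈ v.asIdeal), (Literature.NumberTheory.PAdicHodge.fontainePstAdicCompletion v ℓ hv).IsDeRhamFramed (ρ.toLocal v)) → ∃ π : Literature.NumberTheory.Automorphic.CuspidalAutomorphicRepData n K hcpt, π.1.IsLAlgebraic ∧ ∀ᶠ v : IsDedekindDomain.HeightOneSpectrum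 (NumberField.RingOfIntegers K) in cofinite, SatakeFrobCompatibleAt ι π.1 ρ v := by
  sorry

/-- **LGC° for EVERY datum** (the ∀Rec form; a consequence of the re-typed summit by the weak-to-strong upgrade — its truth
for all canonically pinned data rests on rec being pinned on GENERIC classes by the tree's clauses, census §Negation N2).
[cite: HarrisTaylorAMS2001, Thm. A] [cite: VarmaFMS2024, Thm. 1] -/
theorem stub_pairCompatibilityModuloDeRhamForall :
    ∀ (K : Type) [Field K] [NumberField K] (Rec : ReciprocityData K) (n : ℕ) (hcpt : Literature.NumberTheory.Automorphic.isCompact_glFiniteIntegralLevel n K), 0 < n → ∀ (π : Literature.NumberTheory.Automorphic.CuspidalAutomorphicRepData n K hcpt), π.1.IsLAlgebraic → ∀ (ℓ : ℕ) [Fact ℓ.Prime] (ι : PadicAlgCl ℓ ≃+* ℂ) (ρ : Literature.NumberTheory.GaloisRepresentations.FramedGaloisRep K (PadicAlgCl ℓ) n), ρ.toGaloisRep.IsIrreducible → (∀ᶠ v : IsDedekindDomain.HeightOneSpectrum (NumberField.RingOfIntegers K) in cofinite, SatakeFrobCompatibleAt ι π.1 ρ v) → ∀ v : IsDedekindDomain.HeightOneSpectrum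 (NumberField.RingOfIntegers K), (∀ hv : ((ℓ : ℕ) : NumberField.RingOfIntegers K) ∈ v.asIdeal, (Rec.pst ℓ v hv).IsDeRhamFramed (ρ.toLocal v)) → LocalGlobalCompatibleAt Rec ι π.1 ρ v := by
  sorry

/-- **Composition: N → W⁺ → B_w → LGC°∀ → C′** (sorry-free; uniqueness by the landed `isConjugate_of_satakeFrobCompatibleAt`).
[cite: BuzzardGeeLMS2014, Conj. 3.2.2] -/
theorem ReciprocityModuloDeRham'_of :
    (∀ (K : Type) [Field K] [NumberField K], Nonempty (ReciprocityData K)) → (∀ (K : Type) [Field K] [NumberField K] (n : ℕ) (hcpt : Literature.NumberTheory.Automorphic.isCompact_glFiniteIntegralLevel n K), 0 < n → ∀ (π : Literature.NumberTheory.Automorphic.CuspidalAutomorphicRepData n K hcpt), π.1.IsLAlgebraic → ∀ (ℓ : ℕ) [Fact ℓ.Prime] (ι : PadicAlgCl ℓ ≃+* ℂ), ∃ ρ : Literature.NumberTheory.GaloisRepresentations.FramedGaloisRep K (PadicAlgCl ℓ) n, ρ.toGaloisRep.IsIrreducible ∧ ∀ᶠ v : IsDedekindDomain.HeightOneSpectrum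 (NumberField.RingOfIntegers K) in cofinite, SatakeFrobCompatibleAt ι π.1 ρ v) → (∀ (K : Type) [Field K] [NumberField K] (n : ℕ) (hcpt : Literature.NumberTheory.Automorphic.isCompact_glFiniteIntegralLevel n K), 0 < n → ∀ (ℓ : ℕ) [Fact ℓ.Prime] (ι : PadicAlgCl ℓ ≃+* ℂ) (ρ : Literature.NumberTheory.GaloisRepresentations.FramedGaloisRep K (PadicAlgCl ℓ) n), ρ.toGaloisRep.IsIrreducible → ((∀ᶠ v : IsDedekindDomain.HeightOneSpectrum (NumberField.RingOfIntegers K) in cofinite, ρ.IsUnramifiedAt v) ∧ ∀ (v : IsDedekindDomain.HeightOneSpectrum (NumberField.RingOfIntegers K)) (hv : ((ℓ : ℕ) : NumberField.RingOfIntegers K) ∈ v.asIdeal), (Literature.NumberTheory.PAdicHodge.fontainePstAdicCompletion v ℓ hv).IsDeRhamFramed (ρ.toLocal v)) → ∃ π : Literature.NumberTheory.Automorphic.CuspidalAutomorphicRepData n K hcpt, π.1.IsLAlgebraic ∧ ∀ᶠ v : IsDedekindDomain.HeightOneSpectrum (NumberField.RingOfIntegers K) in cofinite, SatakeFrobCompatibleAt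 ι π.1 ρ v) → (∀ (K : Type) [Field K] [NumberField K] (Rec : ReciprocityData K) (n : ℕ) (hcpt : Literature.NumberTheory.Automorphic.isCompact_glFiniteIntegralLevel n K), 0 < n → ∀ (π : Literature.NumberTheory.Automorphic.CuspidalAutomorphicRepData n K hcpt), π.1.IsLAlgebraic → ∀ (ℓ : ℕ) [Fact ℓ.Prime] (ι : PadicAlgCl ℓ ≃+* ℂ) (ρ : Literature.NumberTheory.GaloisRepresentations.FramedGaloisRep K (PadicAlgCl ℓ) n), ρ.toGaloisRep.IsIrreducible → (∀ᶠ v : IsDedekindDomain.HeightOneSpectrum (NumberField.RingOfIntegers K) in cofinite, SatakeFrobCompatibleAt ι π.1 ρ v) → ∀ v : IsDedekindDomain.HeightOneSpectrum (NumberField.RingOfIntegers K), (∀ hv : ((ℓ : ℕ) : NumberField.RingOfIntegers K) ∈ v.asIdeal, (Rec.pst ℓ v hv).IsDeRhamFramed (ρ.toLocal v)) → LocalGlobalCompatibleAt Rec ι π.1 ρ v) → ReciprocityModuloDeRham' := by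
  intro hN hW hB hL F _ _
  refine ⟨hN F, fun Rec n hn hcpt => ⟨?_, ?_⟩⟩
  · intro π hπ ℓ _ ι
    obtain ⟨ρ, hirr, hsat⟩ := hW F n hcpt hn π hπ ℓ ι
    refine ⟨ρ, hirr, hsat, ?_, ?_, ?_⟩
    · intro v hv
      exact hL F Rec n hcpt hn π hπ ℓ ι ρ hirr hsat v (fun hv' => absurd hv' hv)
    · intro v hv hdR
      exact hL F Rec n hcpt hn π hπ ℓ ι ρ hirr hsat v (fun _ => hdR)
    · intro ρ' hρ'
      exact Theorems.ReciprocityUpToIrreducibility.isConjugate_of_satakeFrobCompatibleAt π.1 ι hirr hsat hρ'.1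
  · intro ℓ _ ι ρ hirr hgeo
    obtain ⟨π, hπ, hsat⟩ := hB F n hcpt hn ℓ ι ρ hirr ⟨hgeo.1, fun v hv => hgeo.2 v hv⟩
    exact ⟨π, hπ, hsat, fun v => hL F Rec n hcpt hn π hπ ℓ ι ρ hirr hsat v (fun hv => hgeo.2 v hv)⟩

theorem ReciprocityModuloDeRham'_of_stubs : ReciprocityModuloDeRham' :=
  ReciprocityModuloDeRham'_of stub_reciprocityDataExist stub_satakeAvatarExistence stub_weakGeometricAutomorphy
    stub_pairCompatibilityModuloDeRhamForall

end Cruxes.ReciprocityModuloDeRham.LeavesForall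

end Summit.Langlands.Langlands.Theses.HeckeFieldDeRham
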